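import Summits.AnomalousDissipation.AnomalousDissipation.Theorems.MomentParityPathField
import Literature.Analysis.FluidPDE.CylindricalGenerator
import Literature.Analysis.FunctionSpaces.TorusFourierSeries

/-!
# Crux `EnsembleRealization` (stmt-AnomalousDissipation-0215) — line `augmented-lift`,
# sub-stub M2a `stub_augLimit`, tools part (iv): identification of the modewise drifts

Supports stmt-AnomalousDissipation-0215 (sub-stub `stub_augLimit` of the reshaped stub
`stub_augmentedLaw`, line `augmented-lift`). Nothing here closes an item.

The Ambrosio–Trevisan identification (arXiv:1402.4788, proof of Thm. 7.1, (7.4)–(7.6)) in tree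
vocabulary, for ONE smooth test mode `a` and ONE pair of rational times `0 ≤ q ≤ q'`. Let `Q` be a
law on the trajectory space `𝒦(R, L)` along which continuous bounded functionals keep the
eventual upper bounds of their means under level laws `P n` (`hleQ`), let the level laws satisfy
the DRIFT LINK for `a` (`hdrift`), and let `c_M` be bounded continuous cylindrical approximants of
the tested generator converging along `L²` fields of energy `≤ R²` to the flux
`∫(⟪w, (w·∇)a⟫ + ν⟪w, Δa⟫ + ⟪f, a⟫)` and on the ball of `H` to `⟨F(u), a⟩` (`hcw`, `hcu`; supplied
by the tools part (iii)). Then the defect functionals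
`Λ_M(ω) = (ω(q'), â) − (ω(q), â) − ∫_q^{q'} c_M(ω̄ τ) dτ` are continuous on `𝒦` with
`E_Q |Λ_M| ≤ (q' − q) ‖⟨F, a⟩ − c_M ∘ 𝓕‖_{L¹(μ)} → 0` (dominated convergence on `μ`, `‖u‖ ≤ R`
a.s.), so by Fatou `liminf_M |Λ_M| = 0` `Q`-a.s.; and along every path field `v` of `ω ∈ 𝒦`,
`Λ_M(ω) → (v q', a) − (v q, a) − ∫_q^{q'} flux(v τ) dτ` (Parseval, dominated convergence in `τ`).
Main statement: `stub_augLimitIdentTools` — the modewise identity between rational times, a.s.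
-/

noncomputable section

set_option linter.dupNamespace false

open MeasureTheory Set Filter Topology Function Metric UnitAddTorus
open scoped BigOperators ENNReal InnerProductSpace RealInnerProductSpace

namespace Summit.AnomalousDissipation.AnomalousDissipation.Theorems.EnsembleRealization

open Literature.Analysis.FunctionSpaces Literature.Analysis.FunctionSpaces.Torus
open Literature.Analysis.FluidPDE Literature.Analysis.FluidPDE.Torus
open Summit.AnomalousDissipation.AnomalousDissipation.Theorems.MomentParity

variable {ν : ℝ} {f a : UnitAddTorus (Fin 3) → EuclideanSpace ℝ (Fin 3)}
  {μ : Measure (Torus.energySpace (Fin 3))} {R : ℝ} {L : (Fin 3 → ℤ) → ℝ} {b : ℝ}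

/-! ### The spectral pairing with a smooth mode -/

/-- **The spectral pairing is continuous on `𝒦`** at every rational time (uniformly convergent
series: `∑ ‖â k‖ < ∞`, `‖ω(q, k)‖ ≤ |R|`). -/
theorem continuous_specPairing (ha : IsSmooth a) (R : ℝ) (L : (Fin 3 → ℤ) → ℝ) (q : ℚ) :
    Continuous fun ω : ↥(pathSpace R L : Set (Path (Fin 3))) => (∑' k : Fin 3 → ℤ, (⟪mFourierCoeff (EuclideanSpace.complexify ∘ a) k, ((ω.1) : Path
          (Fin 3)) ((q), k)⟫_ℂ).re) := by
  refine continuous_tsum (fun k => ?_) ((summable_norm_mFourierCoeff_of_isSmooth ha).mul_right |R|)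
    fun k ω => ?_
  · exact Complex.continuous_re.comp (continuous_const.inner
      ((continuous_apply (q, k)).comp continuous_subtype_val))
  · rw [Real.norm_eq_abs]
    exact (Complex.abs_re_le_norm _).trans ((norm_inner_le_norm _ _).trans
      (mul_le_mul_of_nonneg_left (norm_apply_le_of_mem_pathSpace ω.2 (q, k)) (norm_nonneg _)))

/-- **Parseval for the spectral pairing**: along an `L²` field `w` with `𝓕w = ω̄(q)` (`q ≥ 0`,
`ω ∈ 𝒦`), `(ω(q), â) = ∫ ⟪w, a⟫`. -/
theorem specPairing_eq_integral_inner (ha : IsSmooth a) {ω : Path (Fin 3)} (hω : ω ∈ pathSpace R L)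
    {q : ℚ} (hq : 0 ≤ q) {w : UnitAddTorus (Fin 3) → EuclideanSpace ℝ (Fin 3)} (hw : MemLp w 2 volume)
    (hcoef : ∀ k, mFourierCoeff (EuclideanSpace.complexify ∘ w) k = pathExt ω q k) :
    (∑' k : Fin 3 → ℤ, (⟪mFourierCoeff (EuclideanSpace.complexify ∘ a) k, ((ω) : Path (Fin 3)) ((q), k)⟫_ℂ).re) = ∫ x, ⟪w x, a x⟫_ℝ := by
  have h := hasSum_re_inner_mFourierCoeff_complexify (ha.memLp 2) hw
  simp only [hcoef, pathExt_ratCast hω hq] at h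
  rw [h.tsum_eq]
  exact integral_congr_ae (ae_of_all _ fun x => real_inner_comm _ _)

/-! ### The defect functionals -/

/-- **The defect functionals are continuous on `𝒦`** (for a continuous cylindrical `c`). -/
theorem continuous_defect (ha : IsSmooth a) {c : ((Fin 3 → ℤ) → EuclideanSpace ℂ (Fin 3)) → ℝ}
    (hc : Continuous c) (q q' : ℚ) :
    Continuous fun ω : ↥(pathSpace R L : Set (Path (Fin 3))) => (∑' k : Fin 3 → ℤ, (⟪mFourierCoeff (EuclideanSpace.complexify ∘ a) k, ((ω.1) : Path
          (Fin 3)) ((q'), k)⟫_ℂ).re) - (∑' k : Fin 3 → ℤ, (⟪mFourierCoeff (EuclideanSpace.complexify ∘ a) k, ((ω.1) : Path (Fin 3)) ((q), k)⟫_ℂ).re)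
          - ∫ τ in (q : ℝ)..q', c (fun k => pathExt ω.1 τ k) := by
  have hj : Continuous fun p : ↥(pathSpace R L : Set (Path (Fin 3))) × ℝ => c (fun k => pathExt p.1.1 p.2 k) :=
    hc.comp (continuous_pi fun k => continuous_pathExt_subtype_prod R L k)
  exact ((continuous_specPairing ha R L q').sub (continuous_specPairing ha R L q)).sub
    (intervalIntegral.continuous_parametric_intervalIntegral_of_continuous' hj _ _)

/-- **The mean defect under the limit law**: `E_Q |Λ_c| ≤ (q' − q) ‖⟨F, a⟩ − c ∘ 𝓕‖_{L¹(μ)}`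
(the DRIFT LINK passed to the limit along the bounded continuous functional `|Λ_c|`). -/
theorem integral_abs_defect_le (ha : IsSmooth a) (Q : Measure ↥(pathSpace R L : Set (Path (Fin 3)))) {P : ℕ → Measure (↥(pathSpace R L : Set (Path
      (Fin 3))) × ↥((Set.univ : Set ℚ).pi fun _ : ℚ => Set.Icc (0 : ℝ) b))}
    (hleQ : ∀ g : ↥(pathSpace R L : Set (Path (Fin 3))) → ℝ, Continuous g → ∀ B : ℝ, (∀ ω, |g ω| ≤ B) → ∀ C : ℝ,
      (∀ γ : ℝ, 0 < γ → ∀ᶠ n in atTop, ∫ x, g x.1 ∂(P n) ≤ C + γ) → ∫ ω, g ω ∂Q ≤ C)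
    {c : ((Fin 3 → ℤ) → EuclideanSpace ℂ (Fin 3)) → ℝ} (hc : Continuous c) {q q' : ℚ}
    (hdriftc : ∀ γ : ℝ, 0 < γ → ∀ᶠ n in atTop,
      ∫ x, |(∑' k : Fin 3 → ℤ, (⟪mFourierCoeff (EuclideanSpace.complexify ∘ a) k, ((x.1.1) : Path (Fin 3)) ((q'), k)⟫_ℂ).re) - (∑' k : Fin 3 → ℤ,
            (⟪mFourierCoeff (EuclideanSpace.complexify ∘ a) k, ((x.1.1) : Path (Fin 3)) ((q), k)⟫_ℂ).re) - ∫ τ in (q : ℝ)..q', c (fun k => pathExt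
            x.1.1 τ k)| ∂(P n) ≤
        ((q' : ℝ) - q) * (∫ u, |nsGeneratorPairing ν f u a - c (fun k : Fin 3 → ℤ =>
          mFourierCoeff (EuclideanSpace.complexify ∘ (u.1 : UnitAddTorus (Fin 3) → EuclideanSpace ℝ (Fin 3))) k)| ∂μ) + γ) :
    ∫ ω, |(∑' k : Fin 3 → ℤ, (⟪mFourierCoeff (EuclideanSpace.complexify ∘ a) k, ((ω.1) : Path (Fin 3)) ((q'), k)⟫_ℂ).re) - (∑' k : Fin 3 → ℤ,
          (⟪mFourierCoeff (EuclideanSpace.complexify ∘ a) k, ((ω.1) : Path (Fin 3)) ((q), k)⟫_ℂ).re) - ∫ τ in (q : ℝ)..q', c (fun k => pathExt ω.1 τ k)| ∂Q ≤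
      ((q' : ℝ) - q) * ∫ u, |nsGeneratorPairing ν f u a - c (fun k : Fin 3 → ℤ =>
        mFourierCoeff (EuclideanSpace.complexify ∘ (u.1 : UnitAddTorus (Fin 3) → EuclideanSpace ℝ (Fin 3))) k)| ∂μ := by
  haveI := compactSpace_pathSpace (d := Fin 3) R L
  have hg := (continuous_defect (R := R) (L := L) ha hc q q').abs
  obtain ⟨B, hB⟩ := isCompact_univ.exists_bound_of_continuousOn hg.continuousOn
  exact hleQ _ hg B (fun ω => by rw [← Real.norm_eq_abs]; exact hB ω (mem_univ ω)) _ hdriftc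

/-- The Fourier-coefficient map of the energy space is continuous (product topology). -/
theorem continuous_fieldCoeff' :
    Continuous fun u : Torus.energySpace (Fin 3) => fun k : Fin 3 → ℤ =>
      mFourierCoeff (EuclideanSpace.complexify ∘ (u.1 : UnitAddTorus (Fin 3) → EuclideanSpace ℝ (Fin 3))) k :=
  continuous_pi fun k => (continuous_mFourierCoeff_complexify_coe k).comp continuous_subtype_val

/-- **The `L¹(μ)` errors of the cylindrical approximants vanish in the limit** (dominated
convergence: convergence on the ball `‖u‖ ≤ R`, which carries `μ`; uniform bounds). -/
theorem tendsto_integral_abs_sub_approx (ha : IsSmooth a) [IsFiniteMeasure μ] (hR : ∀ᵐ u ∂μ, ‖u‖ ≤ R)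
    {B : ℝ} {c : ℕ → ((Fin 3 → ℤ) → EuclideanSpace ℂ (Fin 3)) → ℝ} (hc : ∀ M, Continuous (c M))
    (hcB : ∀ M z, |c M z| ≤ B)
    (hcu : ∀ u : Torus.energySpace (Fin 3), ‖u‖ ≤ R →
      Tendsto (fun M => c M fun k => mFourierCoeff (EuclideanSpace.complexify ∘
        (u.1 : UnitAddTorus (Fin 3) → EuclideanSpace ℝ (Fin 3))) k) atTop (𝓝 (nsGeneratorPairing ν f u a))) :
    Tendsto (fun M => ∫ u, |nsGeneratorPairing ν f u a - c M (fun k : Fin 3 → ℤ =>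
      mFourierCoeff (EuclideanSpace.complexify ∘ (u.1 : UnitAddTorus (Fin 3) → EuclideanSpace ℝ (Fin 3))) k)| ∂μ)
      atTop (𝓝 0) := by
  obtain ⟨K, hK0, hK⟩ := exists_abs_nsGeneratorPairing_le ν f ha
  have h := tendsto_integral_of_dominated_convergence (μ := μ) (fun _ => K * (1 + R ^ 2) + B)
    (F := fun M (u : Torus.energySpace (Fin 3)) => |nsGeneratorPairing ν f u a - c M (fun k : Fin 3 → ℤ =>
      mFourierCoeff (EuclideanSpace.complexify ∘ (u.1 : UnitAddTorus (Fin 3) → EuclideanSpace ℝ (Fin 3))) k)|)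
    (f := fun _ => 0) (fun M => ?_) (integrable_const _) (fun M => ?_) ?_
  · simpa using h
  · exact ((continuous_nsGeneratorPairing ν f ha).sub ((hc M).comp continuous_fieldCoeff')).abs.aestronglyMeasurable
  · filter_upwards [hR] with u hu
    rw [Real.norm_eq_abs, abs_abs]
    refine (abs_sub _ _).trans (add_le_add ((hK u).trans (mul_le_mul_of_nonneg_left ?_ hK0)) (hcB M _))
    nlinarith [norm_nonneg u]
  · filter_upwards [hR] with u hu
    have h1 := (tendsto_const_nhds (x := nsGeneratorPairing ν f u a)).sub (hcu u hu)
    rw [sub_self] at h1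
    simpa using h1.abs

/-- **Fatou: the defects vanish along the approximants, almost surely.** If
`E_Q |Λ_M| ≤ (q' − q) D_M` with `D_M → 0`, then `liminf_M |Λ_M(ω)| = 0` for `Q`-a.e. `ω`. -/
theorem ae_liminf_defect_eq_zero (Q : Measure ↥(pathSpace R L : Set (Path (Fin 3)))) [IsFiniteMeasure Q] {Λ : ℕ → ↥(pathSpace R L : Set (Path (Fin 3))) → ℝ}
    (hΛ : ∀ M, Continuous (Λ M)) {D : ℕ → ℝ} (hD : Tendsto D atTop (𝓝 0)) {δ : ℝ}
    (hle : ∀ M, ∫ ω, |Λ M ω| ∂Q ≤ δ * D M) :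
    ∀ᵐ ω ∂Q, liminf (fun M => ENNReal.ofReal |Λ M ω|) atTop = 0 := by
  haveI := compactSpace_pathSpace (d := Fin 3) R L
  have hgm : ∀ M, Measurable fun ω : ↥(pathSpace R L : Set (Path (Fin 3))) => ENNReal.ofReal |Λ M ω| := fun M =>
    (hΛ M).abs.measurable.ennreal_ofReal
  have hint : ∀ M, Integrable (fun ω => |Λ M ω|) Q := fun M => by
    obtain ⟨B, hB⟩ := isCompact_univ.exists_bound_of_continuousOn (hΛ M).abs.continuousOn
    exact Integrable.of_bound (hΛ M).abs.aestronglyMeasurable B (ae_of_all _ fun ω => hB ω (mem_univ ω))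
  have hlin : ∀ M, ∫⁻ ω, ENNReal.ofReal |Λ M ω| ∂Q ≤ ENNReal.ofReal (δ * D M) := fun M => by
    rw [← ofReal_integral_eq_lintegral_ofReal (hint M) (ae_of_all _ fun ω => abs_nonneg _)]
    exact ENNReal.ofReal_le_ofReal (hle M)
  have h0 : Tendsto (fun M => ENNReal.ofReal (δ * D M)) atTop (𝓝 0) := by
    have h := ENNReal.tendsto_ofReal (hD.const_mul δ)
    rwa [mul_zero, ENNReal.ofReal_zero] at h
  have hfatou : ∫⁻ ω, liminf (fun M => ENNReal.ofReal |Λ M ω|) atTop ∂Q = 0 := by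
    refine le_antisymm ?_ bot_le
    calc ∫⁻ ω, liminf (fun M => ENNReal.ofReal |Λ M ω|) atTop ∂Q
        ≤ liminf (fun M => ∫⁻ ω, ENNReal.ofReal |Λ M ω| ∂Q) atTop := lintegral_liminf_le hgm
      _ ≤ liminf (fun M => ENNReal.ofReal (δ * D M)) atTop := liminf_le_liminf (Eventually.of_forall hlin)
      _ = 0 := h0.liminf_eq
  exact (lintegral_eq_zero_iff (Measurable.liminf hgm)).1 hfatou

/-! ### Convergence of the defects along a path field -/

/-- **Along a path field the defects converge to the modewise defect**: for `ω ∈ 𝒦(R, L)`, an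
`L²` family `v t` with `𝓕(v t) = ω̄(t)` (`t ≥ 0`), and approximants `c_M` converging along fields
of energy `≤ R²` to the flux, `Λ_M(ω) → (v q', a) − (v q, a) − ∫_q^{q'} flux(v τ) dτ`. -/
theorem tendsto_defect_pathField (ha : IsSmooth a) {ω : Path (Fin 3)} (hω : ω ∈ pathSpace R L)
    {v : ℝ → UnitAddTorus (Fin 3) → EuclideanSpace ℝ (Fin 3)}
    (hcoef : ∀ t, 0 ≤ t → MemLp (v t) 2 volume ∧
      ∀ k, mFourierCoeff (EuclideanSpace.complexify ∘ v t) k = pathExt ω t k)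
    {B : ℝ} {c : ℕ → ((Fin 3 → ℤ) → EuclideanSpace ℂ (Fin 3)) → ℝ} (hc : ∀ M, Continuous (c M))
    (hcB : ∀ M z, |c M z| ≤ B)
    (hcw : ∀ w : UnitAddTorus (Fin 3) → EuclideanSpace ℝ (Fin 3), MemLp w 2 volume → ∫ x, ‖w x‖ ^ 2 ≤ R ^ 2 →
      Tendsto (fun M => c M fun k => mFourierCoeff (EuclideanSpace.complexify ∘ w) k) atTop (𝓝 (∫ x, (⟪((w) : UnitAddTorus (Fin 3) → EuclideanSpace ℝ
            (Fin 3)) x, convect (w) a x⟫_ℝ + ν * ⟪((w) : UnitAddTorus (Fin 3) → EuclideanSpace ℝ (Fin 3)) x, laplacian a x⟫_ℝ + ⟪f x, a x⟫_ℝ))))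
    {q q' : ℚ} (hq : 0 ≤ q) (hqq : q ≤ q') :
    Tendsto (fun M => (∑' k : Fin 3 → ℤ, (⟪mFourierCoeff (EuclideanSpace.complexify ∘ a) k, ((ω) : Path (Fin 3)) ((q'), k)⟫_ℂ).re) - (∑' k : Fin 3 →
          ℤ, (⟪mFourierCoeff (EuclideanSpace.complexify ∘ a) k, ((ω) : Path (Fin 3)) ((q), k)⟫_ℂ).re) - ∫ τ in (q : ℝ)..q', c M (fun k => pathExt ω τ k)) atTop
      (𝓝 ((∫ x, ⟪v q' x, a x⟫_ℝ) - (∫ x, ⟪v q x, a x⟫_ℝ) - ∫ τ in (q : ℝ)..q', (∫ x, (⟪((v τ) : UnitAddTorus (Fin 3) → EuclideanSpace ℝ (Fin 3)) x,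
            convect (v τ) a x⟫_ℝ + ν * ⟪((v τ) : UnitAddTorus (Fin 3) → EuclideanSpace ℝ (Fin 3)) x, laplacian a x⟫_ℝ + ⟪f x, a x⟫_ℝ)))) := by
  have hq' : (0 : ℚ) ≤ q' := hq.trans hqq
  rw [specPairing_eq_integral_inner ha hω hq' (hcoef _ (by exact_mod_cast hq')).1 (hcoef _ (by exact_mod_cast hq')).2,
    specPairing_eq_integral_inner ha hω hq (hcoef _ (by exact_mod_cast hq)).1 (hcoef _ (by exact_mod_cast hq)).2]
  refine tendsto_const_nhds.sub ?_
  refine intervalIntegral.tendsto_integral_filter_of_dominated_convergence (fun _ => B)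
    (Eventually.of_forall fun M => ?_) (Eventually.of_forall fun M => ae_of_all _ fun τ _ => ?_)
    intervalIntegrable_const (ae_of_all _ fun τ hτ => ?_)
  · exact ((hc M).comp ((continuous_pi fun k => continuous_pathExt_subtype_prod R L k).comp
      (Continuous.prodMk_right (⟨ω, hω⟩ : ↥(pathSpace R L))))).aestronglyMeasurable
  · rw [Real.norm_eq_abs]; exact hcB M _
  · have hτ0 : 0 ≤ τ := by
      rw [uIoc_of_le (by exact_mod_cast hqq)] at hτ
      exact (show (0 : ℝ) ≤ q by exact_mod_cast hq).trans hτ.1.le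
    have hce : (fun k => pathExt ω τ k) = fun k => mFourierCoeff (EuclideanSpace.complexify ∘ v τ) k :=
      funext fun k => ((hcoef τ hτ0).2 k).symm
    rw [hce]
    refine hcw (v τ) (hcoef τ hτ0).1 ?_
    rw [integral_norm_sq_eq_pathEnergyTot (hcoef τ hτ0).1 (hcoef τ hτ0).2]
    exact pathEnergyTot_le hω τ

/-! ### The tools stub -/

/-- **Tools stub (to be registered as `stub_augLimitIdentTools`): the modewise identity between
rational times, almost surely.** Let `Q` be a finite law on `𝒦(R, L)` along which continuous
bounded functionals keep the eventual upper bounds of their means under level laws `P n`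
(`hleQ`); let the level laws satisfy the DRIFT LINK for the smooth test mode `a` (`hdrift`); let
`μ` be a finite measure on `H` carried by the ball `‖u‖ ≤ R`; and let `c_M` be bounded
continuous cylindrical approximants of the tested generator (`hc`, `hcB`, `hcw`, `hcu`). Then
for rationals `0 ≤ q ≤ q'` and `Q`-a.e. path `ω`, EVERY `L²` family `v t` with `𝓕(v t) = ω̄(t)`
(`t ≥ 0`) satisfies `(v q', a) − (v q, a) = ∫_q^{q'} ∫(⟪v, (v·∇)a⟫ + ν⟪v, Δa⟫ + ⟪f, a⟫)`.
[arXiv:1402.4788 §7, proof of Thm. 7.1, (7.4)–(7.6)] -/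
theorem stub_augLimitIdentTools {a : UnitAddTorus (Fin 3) → EuclideanSpace ℝ (Fin 3)} (ha : IsSmooth a) [IsFiniteMeasure μ]
    {R : ℝ} (hR : ∀ᵐ u ∂μ, ‖u‖ ≤ R) {L : (Fin 3 → ℤ) → ℝ} {b : ℝ}
    (Q : Measure ↥(pathSpace R L : Set (Path (Fin 3)))) [IsFiniteMeasure Q] (P : ℕ → Measure (↥(pathSpace R L : Set (Path (Fin 3))) × ↥((Set.univ :
          Set ℚ).pi fun _ : ℚ => Set.Icc (0 : ℝ) b)))
    (hleQ : ∀ g : ↥(pathSpace R L : Set (Path (Fin 3))) → ℝ, Continuous g → ∀ B : ℝ, (∀ ω, |g ω| ≤ B) → ∀ C : ℝ,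
      (∀ γ : ℝ, 0 < γ → ∀ᶠ n in atTop, ∫ x, g x.1 ∂(P n) ≤ C + γ) → ∫ ω, g ω ∂Q ≤ C)
    (hdrift : ∀ c : ((Fin 3 → ℤ) → EuclideanSpace ℂ (Fin 3)) → ℝ, Continuous c → (∃ B : ℝ, ∀ z, |c z| ≤ B) →
      ∀ q q' : ℚ, 0 ≤ q → q ≤ q' → ∀ γ : ℝ, 0 < γ → ∀ᶠ n in atTop,
        ∫ x, |(∑' k, (⟪mFourierCoeff (EuclideanSpace.complexify ∘ a) k, x.1.1 (q', k)⟫_ℂ).re) -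
            (∑' k, (⟪mFourierCoeff (EuclideanSpace.complexify ∘ a) k, x.1.1 (q, k)⟫_ℂ).re) -
            ∫ τ in (q : ℝ)..q', c (fun k : Fin 3 → ℤ => pathExt x.1.1 τ k)| ∂(P n) ≤
          ((q' : ℝ) - q) * (∫ u, |nsGeneratorPairing ν f u a - c (fun k : Fin 3 → ℤ =>
            mFourierCoeff (EuclideanSpace.complexify ∘ (u.1 : UnitAddTorus (Fin 3) → EuclideanSpace ℝ (Fin 3))) k)| ∂μ) + γ)
    {B : ℝ} {c : ℕ → ((Fin 3 → ℤ) → EuclideanSpace ℂ (Fin 3)) → ℝ} (hc : ∀ M, Continuous (c M))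
    (hcB : ∀ M z, |c M z| ≤ B)
    (hcw : ∀ w : UnitAddTorus (Fin 3) → EuclideanSpace ℝ (Fin 3), MemLp w 2 volume → ∫ x, ‖w x‖ ^ 2 ≤ R ^ 2 →
      Tendsto (fun M => c M fun k => mFourierCoeff (EuclideanSpace.complexify ∘ w) k) atTop
        (𝓝 (∫ x, (⟪w x, convect w a x⟫_ℝ + ν * ⟪w x, laplacian a x⟫_ℝ + ⟪f x, a x⟫_ℝ))))
    (hcu : ∀ u : Torus.energySpace (Fin 3), ‖u‖ ≤ R →
      Tendsto (fun M => c M fun k => mFourierCoeff (EuclideanSpace.complexify ∘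
        (u.1 : UnitAddTorus (Fin 3) → EuclideanSpace ℝ (Fin 3))) k) atTop (𝓝 (nsGeneratorPairing ν f u a)))
    {q q' : ℚ} (hq : 0 ≤ q) (hqq : q ≤ q') :
    ∀ᵐ ω ∂Q, ∀ v : ℝ → UnitAddTorus (Fin 3) → EuclideanSpace ℝ (Fin 3),
      (∀ t, 0 ≤ t → MemLp (v t) 2 volume ∧
        ∀ k, mFourierCoeff (EuclideanSpace.complexify ∘ v t) k = pathExt ω.1 t k) →
      (∫ x, ⟪v q' x, a x⟫_ℝ) - (∫ x, ⟪v q x, a x⟫_ℝ) =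
        ∫ τ in (q : ℝ)..q', ∫ x, (⟪v τ x, convect (v τ) a x⟫_ℝ + ν * ⟪v τ x, laplacian a x⟫_ℝ + ⟪f x, a x⟫_ℝ) := by
  -- the defect functionals and their vanishing mean
  set Λ : ℕ → ↥(pathSpace R L : Set (Path (Fin 3))) → ℝ := fun M ω =>
    (∑' k : Fin 3 → ℤ, (⟪mFourierCoeff (EuclideanSpace.complexify ∘ a) k, ω.1 (q', k)⟫_ℂ).re) -
      (∑' k : Fin 3 → ℤ, (⟪mFourierCoeff (EuclideanSpace.complexify ∘ a) k, ω.1 (q, k)⟫_ℂ).re) -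
      ∫ τ in (q : ℝ)..q', c M (fun k => pathExt ω.1 τ k) with hΛ
  have hΛc : ∀ M, Continuous (Λ M) := fun M => continuous_defect (R := R) (L := L) ha (hc M) q q'
  have hle : ∀ M, ∫ ω, |Λ M ω| ∂Q ≤ ((q' : ℝ) - q) * ∫ u, |nsGeneratorPairing ν f u a - c M (fun k : Fin 3 → ℤ =>
      mFourierCoeff (EuclideanSpace.complexify ∘ (u.1 : UnitAddTorus (Fin 3) → EuclideanSpace ℝ (Fin 3))) k)| ∂μ :=
    fun M => integral_abs_defect_le ha Q hleQ (hc M) (hdrift (c M) (hc M) ⟨B, hcB M⟩ q q' hq hqq)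
  have hae := ae_liminf_defect_eq_zero Q hΛc (tendsto_integral_abs_sub_approx ha hR hc hcB hcu) hle
  filter_upwards [hae] with ω hω v hcoef
  -- along the path field the defects converge to the modewise defect, whose `liminf` is `0`
  have ht := tendsto_defect_pathField (ν := ν) (f := f) ha ω.2 hcoef hc hcB hcw hq hqq
  have hlim : liminf (fun M => ENNReal.ofReal |Λ M ω|) atTop = ENNReal.ofReal
      |(∫ x, ⟪v q' x, a x⟫_ℝ) - (∫ x, ⟪v q x, a x⟫_ℝ) - ∫ τ in (q : ℝ)..q',
        ∫ x, (⟪v τ x, convect (v τ) a x⟫_ℝ + ν * ⟪v τ x, laplacian a x⟫_ℝ + ⟪f x, a x⟫_ℝ)| :=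
    ((ENNReal.continuous_ofReal.tendsto _).comp ht.abs).liminf_eq
  rw [hlim] at hω
  have h0 := abs_eq_zero.1 (le_antisymm (ENNReal.ofReal_eq_zero.1 hω) (abs_nonneg _))
  linarith

end Summit.AnomalousDissipation.AnomalousDissipation.Theorems.EnsembleRealization
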